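/-
Copyright (c) 2026 the pub-hodgecm-mathlib formalisation cell (harness21).  Prover seat hodgecm-mathlib-K2E4-p10 (g4), Track B ∕ K2-LIT, h413 =
`stmt-HodgeConjecture-24833`, line `K2_E1_TraceFormulaBeta`, campaign «EIS-RANK-ONE» rung R6h — «(R6h-3 SPH)» dealt by K2E1-plan (g4) 2026-09-04T07:05:29Z: the capstone at the
SPHERICAL VECTOR `φ ≡ φ₀ ≠ 0`, every input but the decay DISCHARGED (★ (R6k) spherical brackets + ★ (R6j) continuity of the `c`-function + Cauchy–Schwarz with equality).
-/
import Summits.HodgeConjecture.HodgeConjecture.Theorems.K2E1MaassSelbergPoleControlCMThreeFinal     -- ★ p858145 (this seat): the capstone + `continuousWithinAt_fourTerm`; ★ p858014 §3 inside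
import Summits.HodgeConjecture.HodgeConjecture.Theorems.K2E1MaassSelbergSphericalBracketsCMThree    -- ★ p858169∕p858174 (K2E4-p14 g6): «(R6k)» `…_final_const`, `idelicBracket_pos∕_eq_ofReal`, `measureReal_maximalCompact_pos`
import Summits.HodgeConjecture.HodgeConjecture.Theorems.K2E1IntertwinedCoeffContinuousCM           -- ★ p858065 (this seat): (R6j) `continuousOn_intertwiningIntegral_flatSectionU_three`, CM `hint`
import HarnessLib

/-!
# K2·E1 — `K2E1MaassSelbergPoleControlSphericalCMThree`: POLE CONTROL AT THE SPHERICAL VECTOR OF `U(2,1)` OVER A CM FIELD, SURVIVORS `hdec′`∕`hdecU` ONLY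
# (campaign «EIS-RANK-ONE», rung R6h, «(R6h-3 SPH)»: milestone «POLE-CONTROL-3-SPH» modulo the decay chain (R3u)₃ + (a3)₃)

Track B ∕ K2-LIT, crux h413 = `stmt-HodgeConjecture-24833`, route of record `HCCMUnconditional`; cell `hodgecm-mathlib`, squad K2, ENGINE E1.  Prover seat
`hodgecm-mathlib-K2E4-p10` (g4); DEAL «(R6h-3 SPH)» of the dealer K2E1-plan (g4) 2026-09-04T07:05:29Z.  THEOREMS ONLY (no `def`, no `instance`, no notation, no named-fact hypothesis, no `sorry`);
lane `--supports stmt-HodgeConjecture-24833 --as helper` (count-neutral).  Closes no socket.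

THE MATHEMATICS [MoeglinWaldspurger1995, II.1.6–II.1.7, IV.2.3, IV.3.12 (a); Arthur1980TraceFormulaII, §4; Garrett2018, §1.12, §2.8, §11.3].  At the spherical vector `φ ≡ φ₀ ≠ 0` the
intertwined coefficient is `c(z)·φ₀` with the SCALAR `c(z) = ∫_{N(𝔸)} H(w₀v)^z dν` (★ (R6k) `intertwinedCoeff_const`), the four `K_U`-averages are the constants `m·φ₀conj φ₀`, `m·φ₀·conj(c(z′)φ₀)`,
`m·c(z)φ₀·conj φ₀`, `m·c(z)φ₀·conj(c(z′)φ₀)` (`m = μ_K(K_U) > 0` ★ `measureReal_maximalCompact_pos`), and the brackets are `κ·(…)` with `κ = ∫_{𝓕_I ∩ {‖x‖≤1}} ‖x‖ dν_I = ↑κ_ℝ`, `κ_ℝ > 0`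
(★ Tate `idelicBracket_pos`∕`_eq_ofReal`); ★ (R6k) `maassSelberg_flatSectionU_cm_three_final_const` is then the relation of record for EVERY `z′` on the sub-tube with survivor `hdec′`.
So the capstone's bracket data are EXPLICIT: `a = κ_ℝ·m·|φ₀|² > 0`, `W = κ·m·φ₀·conj(c(z)φ₀)`, `[Ξ₃] = conj W`, `b = κ_ℝ·m·|c(z)|²·|φ₀|² ≥ 0`, and Cauchy–Schwarz holds with EQUALITY
`‖W‖² = a·b`; the bracket FUNCTIONS `z′ ↦ κ·m·φ₀·conj(c(z′)φ₀)`, `κ·m·c(z)φ₀·conj(c(z′)φ₀)` are continuous at `z` from inside the sub-tube because `c` is continuous on `{Re > 2}` —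
★ (R6j) `continuousOn_intertwiningIntegral_flatSectionU_three` at `φ ≡ 1`, `g = 1` with its `hint` ★ `integrable_borelHeight_weylLongU_mul_rpow_cm_three`.  Feeding ★ p858014 §3
(`hcont` ★ R6g-c, `hΛ′bdd` ★ R6g-a inside) gives **`poleControl_sphericalEisenstein_cm_three`**: for `Re z > 2`, `Im z ≠ 0`, `T ≥ 1`, `φ₀ ≠ 0`, (a1) ∧ (a2) ∧ (a3) with `a, b` EXPLICIT —
in particular `|c(z)|·√(κ_ℝ m)|φ₀| = √b` is bounded off the real axis and `≤ C∕|y|` on vertical approach: the scalar `c`-function of `U(2,1)` obeys IV.3.12 (a)'s inequalities on the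
Godement half-plane.  NAMED SURVIVORS EXACTLY: `hdec′` (pointwise on the sub-tube) and `hdecU` (locally uniform at `z`) — the decay of `E(φ₀H^{z′}) − E(φ₀H^{z′})_B` on `{H > T}`,
payers (R3u)₃ K2E4-p11 + (a3)₃ K2E1-p08; when both are ★ an ED. 2 discharges them (milestone «POLE-CONTROL-3-SPH» unconditional on the Godement range).  CEILING NOT CLAIMED (R7∕R8).
HONEST LABEL: HC_CM is proved only modulo the 7 printed citations (2 remaining named inputs: hLiu418 = `stmt-HodgeConjecture-24832`, h413 = `stmt-HodgeConjecture-24833`) until rung 0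
closes; this file asserts no named fact and closes no socket.
References: [MoeglinWaldspurger1995] II.1.6–II.1.7, IV.2.3, IV.3.12 · [Arthur1980TraceFormulaII] §4 · [Garrett2018] §1.12, §2.8, §11.3.
-/

set_option autoImplicit false
-- the mandated namespace repeats the single-problem summit's segment (`HodgeConjecture.HodgeConjecture`)
set_option linter.dupNamespace false

noncomputable section

open MeasureTheory Measure NumberField IsDedekindDomain Set Filter Topology MulAction
open scoped ENNReal NNReal ComplexConjugate
open Literature.MeasureTheory.Group Literature.NumberTheory
open Literature.NumberTheory.Automorphic Literature.NumberTheory.Automorphic.UnitaryGroup AdelicGroupData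
open Summit.HodgeConjecture.HodgeConjecture.Cruxes.H413.K2E1BorelEisensteinU
open Summit.HodgeConjecture.HodgeConjecture.Cruxes.H413.K2E1MaassSelbergPoleControlCMThree
open Summit.HodgeConjecture.HodgeConjecture.Cruxes.H413.K2E1MaassSelbergPoleControlCMThreeFinal (continuousWithinAt_fourTerm)
open Summit.HodgeConjecture.HodgeConjecture.Cruxes.H413.K2E1MaassSelbergSphericalBracketsCMThree
open Summit.HodgeConjecture.HodgeConjecture.Cruxes.H413.K2E1IntertwinedCoeffContinuousCM

namespace Summit.HodgeConjecture.HodgeConjecture.Cruxes.H413.K2E1MaassSelbergPoleControlSphericalCMThree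

variable (L : Type) [Field L] [NumberField L] [IsCMField L]
variable [MeasurableSpace (quasiSplit (↥(maximalRealSubfield L)) L (IsCMField.complexConj L) 3).Adelic] [BorelSpace (quasiSplit (↥(maximalRealSubfield L)) L (IsCMField.complexConj L) 3).Adelic]
variable [MeasurableSpace (AdeleRing (𝓞 L) L)ˣ] [BorelSpace (AdeleRing (𝓞 L) L)ˣ]

/-- **POLE CONTROL AT THE SPHERICAL VECTOR OF `U(2,1)` OVER A CM FIELD ON THE GODEMENT HALF-PLANE — SURVIVORS `hdec′`∕`hdecU` ONLY.**  For `φ₀ ≠ 0`, `Re z > 2`, `Im z ≠ 0`, `T ≥ 1` and the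
structural data of ★ «CM-FINAL» (automorphic `μ`, Haar `ν_G, μ_K, ν_I`, idele class domain `𝓕_I`, `ν` inversion-invariant Haar on `N(𝔸)` with a fundamental domain `𝓕` of `N(L⁺)`, `ν 𝓕 = 1`,
compact closure — SAT-witness ★ `exists_structural_datum_cm_three`), with `a := κ_ℝ·m·‖φ₀‖²`, `b := κ_ℝ·m·‖c(z)‖²·‖φ₀‖²` (`κ_ℝ = ∫_{𝓕_I∩{‖x‖≤1}}‖x‖`, `m = μ_K(K_U)`, `c(z) = ∫ H(w₀v)^z dν`
complex), `x = Re z − 1`, `y = Im z`: (a1) `√b ≤ x·T^{2x}·√a∕|y| + √(x²T^{4x}a∕y² + aT^{4x})`, (a2) the uniform box form, (a3) `b ≤ C∕y²` for `|y| ≤ 1`.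
[cite: MoeglinWaldspurger1995, IV.2.3 and IV.3.12 (a)] [cite: Arthur1980TraceFormulaII, §4] [cite: Garrett2018, §1.12 and §11.3] -/
theorem poleControl_sphericalEisenstein_cm_three
    (μ : Measure (quasiSplit (↥(maximalRealSubfield L)) L (IsCMField.complexConj L) 3).automorphicQuotient) [(quasiSplit (↥(maximalRealSubfield L)) L (IsCMField.complexConj L) 3).IsAutomorphicMeasure μ]
    (νG : Measure (quasiSplit (↥(maximalRealSubfield L)) L (IsCMField.complexConj L) 3).Adelic) [νG.IsHaarMeasure] [νG.IsInvInvariant]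
    (μK : Measure ((standardMaximalCompactGL 3 L).comap (adelicVal (↥(maximalRealSubfield L)) L (IsCMField.complexConj L) 3 ((StdForm.antidiagonal 3).over L)) : Subgroup (quasiSplit (↥(maximalRealSubfield L)) L (IsCMField.complexConj L) 3).Adelic))
    [μK.IsHaarMeasure]
    (νI : Measure (AdeleRing (𝓞 L) L)ˣ) [νI.IsHaarMeasure]
    {𝓕I : Set (AdeleRing (𝓞 L) L)ˣ} (h𝓕I : IsIdeleClassDomain L 𝓕I)
    (ν : Measure ↥(adelicUnipotent (↥(maximalRealSubfield L)) L (IsCMField.complexConj L) 3)) [ν.IsHaarMeasure] [ν.IsInvInvariant]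
    {𝓕 : Set ↥(adelicUnipotent (↥(maximalRealSubfield L)) L (IsCMField.complexConj L) 3)} (h𝓕N : IsFundamentalDomain ↥(rationalUnipotent (↥(maximalRealSubfield L)) L (IsCMField.complexConj L) 3) 𝓕 ν) (h𝓕1 : ν 𝓕 = 1) (h𝓕c : IsCompact (closure 𝓕))
    {β : (quasiSplit (↥(maximalRealSubfield L)) L (IsCMField.complexConj L) 3).Adelic → ℝ≥0∞} (hβ : IsCoveringWeight ((arithmeticBorel (↥(maximalRealSubfield L)) L (IsCMField.complexConj L) 3).map (quasiSplit (↥(maximalRealSubfield L)) L (IsCMField.complexConj L) 3).arithmeticSubgroup.subtype) β)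
    {T : ℝ≥0} (hT : 1 ≤ T) {φ₀ : ℂ} (hφ₀ : φ₀ ≠ 0) {z : ℂ} (hz : 2 < z.re) (hy : z.im ≠ 0)
    -- THE ONLY NAMED INPUTS: the decay of `E(φ₀H^{z′}) − E(φ₀H^{z′})_B` on `{H > T}`, pointwise on the sub-tube and locally uniformly at `z` ([D2] chain: (R3u)₃ + (a3)₃)
    (hdec' : ∀ z' : ℂ, 2 < z'.re → z'.re < z.re → ∃ M₁' : ℝ, ∀ g : (quasiSplit (↥(maximalRealSubfield L)) L (IsCMField.complexConj L) 3).Adelic, T < borelHeight g →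
      ‖eisensteinSeriesU (flatSectionU (fun _ : (quasiSplit (↥(maximalRealSubfield L)) L (IsCMField.complexConj L) 3).Adelic => φ₀) z') g - borelConstantTerm ν 𝓕 (eisensteinSeriesU (flatSectionU (fun _ : (quasiSplit (↥(maximalRealSubfield L)) L (IsCMField.complexConj L) 3).Adelic => φ₀) z')) g‖ ≤ M₁')
    {V : Set ℂ} (hV : V ∈ 𝓝 z) {M₁ : ℝ}
    (hdecU : ∀ z' ∈ V, ∀ g : (quasiSplit (↥(maximalRealSubfield L)) L (IsCMField.complexConj L) 3).Adelic, T < borelHeight g →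
      ‖eisensteinSeriesU (flatSectionU (fun _ : (quasiSplit (↥(maximalRealSubfield L)) L (IsCMField.complexConj L) 3).Adelic => φ₀) z') g - borelConstantTerm ν 𝓕 (eisensteinSeriesU (flatSectionU (fun _ : (quasiSplit (↥(maximalRealSubfield L)) L (IsCMField.complexConj L) 3).Adelic => φ₀) z')) g‖ ≤ M₁) :
    Real.sqrt ((∫ x in {x : (AdeleRing (𝓞 L) L)ˣ | (IdeleClassGroup.ideleNorm L x : ℝ) ≤ 1} ∩ 𝓕I, (IdeleClassGroup.ideleNorm L x : ℝ) ∂νI) * μK.real Set.univ * ‖(∫ v : ↥(adelicUnipotent (↥(maximalRealSubfield L)) L (IsCMField.complexConj L) 3), (((borelHeight ((quasiSplit (↥(maximalRealSubfield L)) L (IsCMField.complexConj L) 3).toAdelic (weylLongU ((IsCMField.complexConj L : L ≃ₐ[↥(maximalRealSubfield L)] L) : L →+* L) (rfl : (StdForm.antidiagonal 3).over L = (StdForm.antidiagonal 3).over L)) * (v : (quasiSplit (↥(maximalRealSubfield L)) L (IsCMField.complexConj L) 3).Adelic))) : ℝ) : ℂ) ^ z ∂ν)‖ ^ 2 * ‖φ₀‖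 ^ 2) ≤
        (z.re - 1) * (T : ℝ) ^ (2 * (z.re - 1)) * Real.sqrt ((∫ x in {x : (AdeleRing (𝓞 L) L)ˣ | (IdeleClassGroup.ideleNorm L x : ℝ) ≤ 1} ∩ 𝓕I, (IdeleClassGroup.ideleNorm L x : ℝ) ∂νI) * μK.real Set.univ * ‖φ₀‖ ^ 2) / |z.im| +
          Real.sqrt ((z.re - 1) ^ 2 * (T : ℝ) ^ (4 * (z.re - 1)) * ((∫ x in {x : (AdeleRing (𝓞 L) L)ˣ | (IdeleClassGroup.ideleNorm L x : ℝ) ≤ 1} ∩ 𝓕I, (IdeleClassGroup.ideleNorm L x : ℝ) ∂νI) * μK.real Set.univ * ‖φ₀‖ ^ 2) / z.im ^ 2 + ((∫ x in {x : (AdeleRing (𝓞 L) L)ˣ | (IdeleClassGroup.ideleNorm L x : ℝ) ≤ 1} ∩ 𝓕I, (IdeleClassGroup.ideleNorm L x : ℝ) ∂νI) * μK.real Set.univ * ‖φ₀‖ ^ 2) * (T : ℝ) ^ (4 * (z.re - 1))) ∧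
      (∀ {x₁ x₂ η : ℝ}, 0 < x₁ → z.re - 1 ∈ Set.Icc x₁ x₂ → 0 < η → η ≤ |z.im| →
        ((∫ x in {x : (AdeleRing (𝓞 L) L)ˣ | (IdeleClassGroup.ideleNorm L x : ℝ) ≤ 1} ∩ 𝓕I, (IdeleClassGroup.ideleNorm L x : ℝ) ∂νI) * μK.real Set.univ * ‖(∫ v : ↥(adelicUnipotent (↥(maximalRealSubfield L)) L (IsCMField.complexConj L) 3), (((borelHeight ((quasiSplit (↥(maximalRealSubfield L)) L (IsCMField.complexConj L) 3).toAdelic (weylLongU ((IsCMField.complexConj L : L ≃ₐ[↥(maximalRealSubfield L)] L) : L →+* L) (rfl : (StdForm.antidiagonal 3).over L = (StdForm.antidiagonal 3).over L)) * (v : (quasiSplit (↥(maximalRealSubfield L)) L (IsCMField.complexConj L) 3).Adelic))) : ℝ) : ℂ) ^ z ∂ν)‖ ^ 2 * ‖φ₀‖ ^ 2) ≤ (x₂ * (T : ℝ) ^ (2 * x₂) * Real.sqrt ((∫ x in {x : (AdeleRing (𝓞 L) L)ˣ | (IdeleClassGroup.ideleNorm L x : ℝ) ≤ 1} ∩ 𝓕I,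 (IdeleClassGroup.ideleNorm L x : ℝ) ∂νI) * μK.real Set.univ * ‖φ₀‖ ^ 2) / η + Real.sqrt (x₂ ^ 2 * (T : ℝ) ^ (4 * x₂) * ((∫ x in {x : (AdeleRing (𝓞 L) L)ˣ | (IdeleClassGroup.ideleNorm L x : ℝ) ≤ 1} ∩ 𝓕I, (IdeleClassGroup.ideleNorm L x : ℝ) ∂νI) * μK.real Set.univ * ‖φ₀‖ ^ 2) / η ^ 2 + ((∫ x in {x : (AdeleRing (𝓞 L) L)ˣ | (IdeleClassGroup.ideleNorm L x : ℝ) ≤ 1} ∩ 𝓕I, (IdeleClassGroup.ideleNorm L x : ℝ) ∂νI) * μK.real Set.univ * ‖φ₀‖ ^ 2) * (T : ℝ) ^ (4 * x₂))) ^ 2) ∧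
      (|z.im| ≤ 1 → ((∫ x in {x : (AdeleRing (𝓞 L) L)ˣ | (IdeleClassGroup.ideleNorm L x : ℝ) ≤ 1} ∩ 𝓕I, (IdeleClassGroup.ideleNorm L x : ℝ) ∂νI) * μK.real Set.univ * ‖(∫ v : ↥(adelicUnipotent (↥(maximalRealSubfield L)) L (IsCMField.complexConj L) 3), (((borelHeight ((quasiSplit (↥(maximalRealSubfield L)) L (IsCMField.complexConj L) 3).toAdelic (weylLongU ((IsCMField.complexConj L : L ≃ₐ[↥(maximalRealSubfield L)] L) : L →+* L) (rfl : (StdForm.antidiagonal 3).over L = (StdForm.antidiagonal 3).over L)) * (v : (quasiSplit (↥(maximalRealSubfield L)) L (IsCMField.complexConj L) 3).Adelic))) : ℝ) : ℂ) ^ z ∂ν)‖ ^ 2 * ‖φ₀‖ ^ 2) ≤ ((z.re - 1) * (T : ℝ) ^ (2 * (z.re - 1)) * Real.sqrt ((∫ x in {x : (AdeleRing (𝓞 L) L)ˣ | (IdeleClassGroup.ideleNorm L x : ℝ) ≤ 1} ∩ 𝓕I, (IdeleClassGroup.ideleNorm L x : ℝ) ∂νI) * μK.real Set.univ * ‖φ₀‖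 ^ 2) +
        Real.sqrt ((z.re - 1) ^ 2 * (T : ℝ) ^ (4 * (z.re - 1)) * ((∫ x in {x : (AdeleRing (𝓞 L) L)ˣ | (IdeleClassGroup.ideleNorm L x : ℝ) ≤ 1} ∩ 𝓕I, (IdeleClassGroup.ideleNorm L x : ℝ) ∂νI) * μK.real Set.univ * ‖φ₀‖ ^ 2) + ((∫ x in {x : (AdeleRing (𝓞 L) L)ˣ | (IdeleClassGroup.ideleNorm L x : ℝ) ≤ 1} ∩ 𝓕I, (IdeleClassGroup.ideleNorm L x : ℝ) ∂νI) * μK.real Set.univ * ‖φ₀‖ ^ 2) * (T : ℝ) ^ (4 * (z.re - 1)))) ^ 2 / z.im ^ 2) := by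
  haveI := t2Space_adeleRing_of_numberField L
  obtain ⟨cμ, K, hcμ, hK, hconst⟩ := maassSelberg_flatSectionU_cm_three_final_const L μ νG μK νI h𝓕I ν h𝓕N h𝓕1 h𝓕c
  have hT0 : (0 : ℝ) < (T : ℝ) := lt_of_lt_of_le one_pos (by exact_mod_cast hT)
  -- the three positive scalars `κ_ℝ`, `m`, `|φ₀|` and the complex `c`-function
  have hκ : (∫ x in {x : (AdeleRing (𝓞 L) L)ˣ | (IdeleClassGroup.ideleNorm L x : ℝ) ≤ 1} ∩ 𝓕I, ((IdeleClassGroup.ideleNorm L x : ℝ) : ℂ) ∂νI) = (((∫ x in {x : (AdeleRing (𝓞 L) L)ˣ | (IdeleClassGroup.ideleNorm L x : ℝ) ≤ 1} ∩ 𝓕I, (IdeleClassGroup.ideleNorm L x : ℝ) ∂νI) : ℝ) : ℂ) := idelicBracket_eq_ofReal νI 𝓕I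
  have hκr : 0 < (∫ x in {x : (AdeleRing (𝓞 L) L)ˣ | (IdeleClassGroup.ideleNorm L x : ℝ) ≤ 1} ∩ 𝓕I, (IdeleClassGroup.ideleNorm L x : ℝ) ∂νI) := idelicBracket_pos νI h𝓕I
  have hm : 0 < μK.real Set.univ := measureReal_maximalCompact_pos μK
  have hφ₀' : 0 < ‖φ₀‖ := norm_pos_iff.2 hφ₀
  -- `c` is continuous on `{Re > 2}` (★ (R6j) at `φ ≡ 1`, `g = 1`), hence within the sub-tube at `z`
  have hcOn : ContinuousOn (fun w : ℂ => (∫ v : ↥(adelicUnipotent (↥(maximalRealSubfield L)) L (IsCMField.complexConj L) 3), (((borelHeight ((quasiSplit (↥(maximalRealSubfield L)) L (IsCMField.complexConj L) 3).toAdelic (weylLongU ((IsCMField.complexConj L : L ≃ₐ[↥(maximalRealSubfield L)] L) : L →+* L) (rfl : (StdForm.antidiagonal 3).over L = (StdForm.antidiagonal 3).over L)) * (v : (quasiSplit (↥(maximalRealSubfield L)) L (IsCMField.complexConj L) 3).Adelic))) : ℝ) : ℂ) ^ w ∂ν)) {w : ℂ | 2 < w.re} := by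
    have h := continuousOn_intertwiningIntegral_flatSectionU_three ν (φ := fun _ : (quasiSplit (↥(maximalRealSubfield L)) L (IsCMField.complexConj L) 3).Adelic => (1 : ℂ)) measurable_const (Cφ := ‖(1 : ℂ)‖) (fun _ => le_rfl) (1 : (quasiSplit (↥(maximalRealSubfield L)) L (IsCMField.complexConj L) 3).Adelic) (σ₀ := 2)
      fun σ hσ => integrable_borelHeight_weylLongU_mul_rpow_cm_three L ν h𝓕N h𝓕c hσ 1
    simpa only [flatSectionU_apply, one_mul, mul_one] using h
  have hcz : ContinuousWithinAt (fun w : ℂ => (∫ v : ↥(adelicUnipotent (↥(maximalRealSubfield L)) L (IsCMField.complexConj L) 3), (((borelHeight ((quasiSplit (↥(maximalRealSubfield L)) L (IsCMField.complexConj L) 3).toAdelic (weylLongU ((IsCMField.complexConj L : L ≃ₐ[↥(maximalRealSubfield L)] L) : L →+* L) (rfl : (StdForm.antidiagonal 3).over L = (StdForm.antidiagonal 3).over L)) * (v : (quasiSplit (↥(maximalRealSubfield L)) L (IsCMField.complexConj L) 3).Adelic))) : ℝ) : ℂ) ^ w ∂ν)) {z' : ℂ | 2 < z'.re ∧ z'.re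 < z.re} z :=
    (hcOn.continuousAt ((isOpen_lt continuous_const Complex.continuous_re).mem_nhds hz)).continuousWithinAt
  have hB₂ : ContinuousWithinAt (fun z' : ℂ => (∫ x in {x : (AdeleRing (𝓞 L) L)ˣ | (IdeleClassGroup.ideleNorm L x : ℝ) ≤ 1} ∩ 𝓕I, ((IdeleClassGroup.ideleNorm L x : ℝ) : ℂ) ∂νI) * (((μK.real Set.univ : ℝ) : ℂ) * (φ₀ * conj ((∫ v : ↥(adelicUnipotent (↥(maximalRealSubfield L)) L (IsCMField.complexConj L) 3), (((borelHeight ((quasiSplit (↥(maximalRealSubfield L)) L (IsCMField.complexConj L) 3).toAdelic (weylLongU ((IsCMField.complexConj L : L ≃ₐ[↥(maximalRealSubfield L)] L) : L →+* L) (rfl : (StdForm.antidiagonal 3).over L = (StdForm.antidiagonal 3).over L)) * (v : (quasiSplit (↥(maximalRealSubfield L)) L (IsCMField.complexConj L) 3).Adelic))) : ℝ) : ℂ) ^ z' ∂ν) * φ₀)))) {z' : ℂ | 2 < z'.re ∧ z'.re < z.re} z := by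
    have h1 : ContinuousWithinAt (fun z' : ℂ => conj ((∫ v : ↥(adelicUnipotent (↥(maximalRealSubfield L)) L (IsCMField.complexConj L) 3), (((borelHeight ((quasiSplit (↥(maximalRealSubfield L)) L (IsCMField.complexConj L) 3).toAdelic (weylLongU ((IsCMField.complexConj L : L ≃ₐ[↥(maximalRealSubfield L)] L) : L →+* L) (rfl : (StdForm.antidiagonal 3).over L = (StdForm.antidiagonal 3).over L)) * (v : (quasiSplit (↥(maximalRealSubfield L)) L (IsCMField.complexConj L) 3).Adelic))) : ℝ) : ℂ) ^ z' ∂ν) * φ₀)) {z' : ℂ | 2 < z'.re ∧ z'.re < z.re} z := by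
      have h2 := Complex.continuous_conj.continuousAt.comp_continuousWithinAt (hcz.mul (continuousWithinAt_const (b := φ₀)))
      rw [Function.comp_def] at h2
      exact h2
    exact continuousWithinAt_const.mul (continuousWithinAt_const.mul (continuousWithinAt_const.mul h1))
  have hB₄ : ContinuousWithinAt (fun z' : ℂ => (∫ x in {x : (AdeleRing (𝓞 L) L)ˣ | (IdeleClassGroup.ideleNorm L x : ℝ) ≤ 1} ∩ 𝓕I, ((IdeleClassGroup.ideleNorm L x : ℝ) : ℂ) ∂νI) * (((μK.real Set.univ : ℝ) : ℂ) * ((∫ v : ↥(adelicUnipotent (↥(maximalRealSubfield L)) L (IsCMField.complexConj L) 3), (((borelHeight ((quasiSplit (↥(maximalRealSubfield L)) L (IsCMField.complexConj L) 3).toAdelic (weylLongU ((IsCMField.complexConj L : L ≃ₐ[↥(maximalRealSubfield L)] L) : L →+* L) (rfl : (StdForm.antidiagonal 3).over L = (StdForm.antidiagonal 3).over L)) * (v : (quasiSplit (↥(maximalRealSubfield L)) L (IsCMField.complexConj L) 3).Adelic))) : ℝ) : ℂ) ^ z ∂ν) * φ₀ * conj ((∫ v : ↥(adelicUnipotent (↥(maximalRealSubfield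 L)) L (IsCMField.complexConj L) 3), (((borelHeight ((quasiSplit (↥(maximalRealSubfield L)) L (IsCMField.complexConj L) 3).toAdelic (weylLongU ((IsCMField.complexConj L : L ≃ₐ[↥(maximalRealSubfield L)] L) : L →+* L) (rfl : (StdForm.antidiagonal 3).over L = (StdForm.antidiagonal 3).over L)) * (v : (quasiSplit (↥(maximalRealSubfield L)) L (IsCMField.complexConj L) 3).Adelic))) : ℝ) : ℂ) ^ z' ∂ν) * φ₀)))) {z' : ℂ | 2 < z'.re ∧ z'.re < z.re} z := by
    have h1 : ContinuousWithinAt (fun z' : ℂ => conj ((∫ v : ↥(adelicUnipotent (↥(maximalRealSubfield L)) L (IsCMField.complexConj L) 3), (((borelHeight ((quasiSplit (↥(maximalRealSubfield L)) L (IsCMField.complexConj L) 3).toAdelic (weylLongU ((IsCMField.complexConj L : L ≃ₐ[↥(maximalRealSubfield L)] L) : L →+* L) (rfl : (StdForm.antidiagonal 3).over L = (StdForm.antidiagonal 3).over L)) * (v : (quasiSplit (↥(maximalRealSubfield L)) L (IsCMField.complexConj L) 3).Adelic))) : ℝ) : ℂ) ^ z' ∂ν) * φ₀)) {z' : ℂ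 | 2 < z'.re ∧ z'.re < z.re} z := by
      have h2 := Complex.continuous_conj.continuousAt.comp_continuousWithinAt (hcz.mul (continuousWithinAt_const (b := φ₀)))
      rw [Function.comp_def] at h2
      exact h2
    exact continuousWithinAt_const.mul (continuousWithinAt_const.mul (continuousWithinAt_const.mul h1))
  -- the right side of record as a FUNCTION of `z′` (★ (R6k) shape at `φ ≡ φ′ ≡ φ₀`)
  set R : ℂ → ℂ := fun z' => (cμ : ℂ) * ((K : ℂ) *
    ((((T : ℝ) : ℂ) ^ (z + conj z' - 2) / (z + conj z' - 2)) * ((∫ x in {x : (AdeleRing (𝓞 L) L)ˣ | (IdeleClassGroup.ideleNorm L x : ℝ) ≤ 1} ∩ 𝓕I, ((IdeleClassGroup.ideleNorm L x : ℝ) : ℂ) ∂νI) * (((μK.real Set.univ : ℝ) : ℂ) * (φ₀ * conj φ₀)))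
      + (((T : ℝ) : ℂ) ^ (z - conj z') / (z - conj z')) * ((∫ x in {x : (AdeleRing (𝓞 L) L)ˣ | (IdeleClassGroup.ideleNorm L x : ℝ) ≤ 1} ∩ 𝓕I, ((IdeleClassGroup.ideleNorm L x : ℝ) : ℂ) ∂νI) * (((μK.real Set.univ : ℝ) : ℂ) * (φ₀ * conj ((∫ v : ↥(adelicUnipotent (↥(maximalRealSubfield L)) L (IsCMField.complexConj L) 3), (((borelHeight ((quasiSplit (↥(maximalRealSubfield L)) L (IsCMField.complexConj L) 3).toAdelic (weylLongU ((IsCMField.complexConj L : L ≃ₐ[↥(maximalRealSubfield L)] L) : L →+* L) (rfl : (StdForm.antidiagonal 3).over L = (StdForm.antidiagonal 3).over L)) * (v : (quasiSplit (↥(maximalRealSubfield L)) L (IsCMField.complexConj L) 3).Adelic))) : ℝ) : ℂ) ^ z' ∂ν) * φ₀))))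
      - (((T : ℝ) : ℂ) ^ (-(z - conj z')) / (z - conj z')) * ((∫ x in {x : (AdeleRing (𝓞 L) L)ˣ | (IdeleClassGroup.ideleNorm L x : ℝ) ≤ 1} ∩ 𝓕I, ((IdeleClassGroup.ideleNorm L x : ℝ) : ℂ) ∂νI) * (((μK.real Set.univ : ℝ) : ℂ) * ((∫ v : ↥(adelicUnipotent (↥(maximalRealSubfield L)) L (IsCMField.complexConj L) 3), (((borelHeight ((quasiSplit (↥(maximalRealSubfield L)) L (IsCMField.complexConj L) 3).toAdelic (weylLongU ((IsCMField.complexConj L : L ≃ₐ[↥(maximalRealSubfield L)] L) : L →+* L) (rfl : (StdForm.antidiagonal 3).over L = (StdForm.antidiagonal 3).over L)) * (v : (quasiSplit (↥(maximalRealSubfield L)) L (IsCMField.complexConj L) 3).Adelic))) : ℝ) : ℂ) ^ z ∂ν) * φ₀ * conj φ₀)))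
      - (((T : ℝ) : ℂ) ^ (-(z + conj z' - 2)) / (z + conj z' - 2)) * ((∫ x in {x : (AdeleRing (𝓞 L) L)ˣ | (IdeleClassGroup.ideleNorm L x : ℝ) ≤ 1} ∩ 𝓕I, ((IdeleClassGroup.ideleNorm L x : ℝ) : ℂ) ∂νI) * (((μK.real Set.univ : ℝ) : ℂ) * ((∫ v : ↥(adelicUnipotent (↥(maximalRealSubfield L)) L (IsCMField.complexConj L) 3), (((borelHeight ((quasiSplit (↥(maximalRealSubfield L)) L (IsCMField.complexConj L) 3).toAdelic (weylLongU ((IsCMField.complexConj L : L ≃ₐ[↥(maximalRealSubfield L)] L) : L →+* L) (rfl : (StdForm.antidiagonal 3).over L = (StdForm.antidiagonal 3).over L)) * (v : (quasiSplit (↥(maximalRealSubfield L)) L (IsCMField.complexConj L) 3).Adelic))) : ℝ) : ℂ) ^ z ∂ν) * φ₀ * conj ((∫ v : ↥(adelicUnipotent (↥(maximalRealSubfield L)) L (IsCMField.complexConj L) 3), (((borelHeight ((quasiSplit (↥(maximalRealSubfield L)) L (IsCMField.complexConj L) 3).toAdelic (weylLongU ((IsCMField.complexConj L : L ≃ₐ[↥(maximalRealSubfield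 L)] L) : L →+* L) (rfl : (StdForm.antidiagonal 3).over L = (StdForm.antidiagonal 3).over L)) * (v : (quasiSplit (↥(maximalRealSubfield L)) L (IsCMField.complexConj L) 3).Adelic))) : ℝ) : ℂ) ^ z' ∂ν) * φ₀)))))) with hRdef
  have hrel : ∀ z' : ℂ, 2 < z'.re → z'.re < z.re →
      ∫ x, (quasiSplit (↥(maximalRealSubfield L)) L (IsCMField.complexConj L) 3).quotFun (truncation ν 𝓕 T (eisensteinSeriesU (flatSectionU (fun _ : (quasiSplit (↥(maximalRealSubfield L)) L (IsCMField.complexConj L) 3).Adelic => φ₀) z))) x * conj ((quasiSplit (↥(maximalRealSubfield L)) L (IsCMField.complexConj L) 3).quotFun (truncation ν 𝓕 T (eisensteinSeriesU (flatSectionU (fun _ : (quasiSplit (↥(maximalRealSubfield L)) L (IsCMField.complexConj L) 3).Adelic => φ₀) z'))) x) ∂μ = R z' := by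
    intro z' hz' hzz'
    obtain ⟨M₁', hd⟩ := hdec' z' hz' hzz'
    rw [hRdef]
    exact hconst hβ hT φ₀ φ₀ hz' hzz' hd
  have hs₁ : z + conj z - 2 ≠ 0 := by
    have hx : (0 : ℝ) < 2 * (z.re - 1) := by linarith
    rw [add_conj_sub_two_eq]; exact_mod_cast hx.ne'
  have hs₂ : z - conj z ≠ 0 := by
    rw [Complex.sub_conj]; exact mul_ne_zero (by exact_mod_cast (show (2 * z.im : ℝ) ≠ 0 from mul_ne_zero two_ne_zero hy)) Complex.I_ne_zero
  have hR : ContinuousWithinAt R {z' : ℂ | 2 < z'.re ∧ z'.re < z.re} z := by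
    rw [hRdef]; exact continuousWithinAt_fourTerm hT0 hs₁ hs₂ hB₂ hB₄
  have hRz : R z = (cμ : ℂ) * ((K : ℂ) *
    ((((T : ℝ) : ℂ) ^ (z + conj z - 2) / (z + conj z - 2)) * ((∫ x in {x : (AdeleRing (𝓞 L) L)ˣ | (IdeleClassGroup.ideleNorm L x : ℝ) ≤ 1} ∩ 𝓕I, ((IdeleClassGroup.ideleNorm L x : ℝ) : ℂ) ∂νI) * (((μK.real Set.univ : ℝ) : ℂ) * (φ₀ * conj φ₀)))
      + (((T : ℝ) : ℂ) ^ (z - conj z) / (z - conj z)) * ((∫ x in {x : (AdeleRing (𝓞 L) L)ˣ | (IdeleClassGroup.ideleNorm L x : ℝ) ≤ 1} ∩ 𝓕I, ((IdeleClassGroup.ideleNorm L x : ℝ) : ℂ) ∂νI) * (((μK.real Set.univ : ℝ) : ℂ) * (φ₀ * conj ((∫ v : ↥(adelicUnipotent (↥(maximalRealSubfield L)) L (IsCMField.complexConj L) 3), (((borelHeight ((quasiSplit (↥(maximalRealSubfield L)) L (IsCMField.complexConj L) 3).toAdelic (weylLongU ((IsCMField.complexConj L : L ≃ₐ[↥(maximalRealSubfield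 L)] L) : L →+* L) (rfl : (StdForm.antidiagonal 3).over L = (StdForm.antidiagonal 3).over L)) * (v : (quasiSplit (↥(maximalRealSubfield L)) L (IsCMField.complexConj L) 3).Adelic))) : ℝ) : ℂ) ^ z ∂ν) * φ₀))))
      - (((T : ℝ) : ℂ) ^ (-(z - conj z)) / (z - conj z)) * ((∫ x in {x : (AdeleRing (𝓞 L) L)ˣ | (IdeleClassGroup.ideleNorm L x : ℝ) ≤ 1} ∩ 𝓕I, ((IdeleClassGroup.ideleNorm L x : ℝ) : ℂ) ∂νI) * (((μK.real Set.univ : ℝ) : ℂ) * ((∫ v : ↥(adelicUnipotent (↥(maximalRealSubfield L)) L (IsCMField.complexConj L) 3), (((borelHeight ((quasiSplit (↥(maximalRealSubfield L)) L (IsCMField.complexConj L) 3).toAdelic (weylLongU ((IsCMField.complexConj L : L ≃ₐ[↥(maximalRealSubfield L)] L) : L →+* L) (rfl : (StdForm.antidiagonal 3).over L = (StdForm.antidiagonal 3).over L)) * (v : (quasiSplit (↥(maximalRealSubfield L)) L (IsCMField.complexConj L) 3).Adelic))) : ℝ) : ℂ) ^ z ∂ν) * φ₀ * conj φ₀)))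
      - (((T : ℝ) : ℂ) ^ (-(z + conj z - 2)) / (z + conj z - 2)) * ((∫ x in {x : (AdeleRing (𝓞 L) L)ˣ | (IdeleClassGroup.ideleNorm L x : ℝ) ≤ 1} ∩ 𝓕I, ((IdeleClassGroup.ideleNorm L x : ℝ) : ℂ) ∂νI) * (((μK.real Set.univ : ℝ) : ℂ) * ((∫ v : ↥(adelicUnipotent (↥(maximalRealSubfield L)) L (IsCMField.complexConj L) 3), (((borelHeight ((quasiSplit (↥(maximalRealSubfield L)) L (IsCMField.complexConj L) 3).toAdelic (weylLongU ((IsCMField.complexConj L : L ≃ₐ[↥(maximalRealSubfield L)] L) : L →+* L) (rfl : (StdForm.antidiagonal 3).over L = (StdForm.antidiagonal 3).over L)) * (v : (quasiSplit (↥(maximalRealSubfield L)) L (IsCMField.complexConj L) 3).Adelic))) : ℝ) : ℂ) ^ z ∂ν) * φ₀ * conj ((∫ v : ↥(adelicUnipotent (↥(maximalRealSubfield L)) L (IsCMField.complexConj L) 3), (((borelHeight ((quasiSplit (↥(maximalRealSubfield L)) L (IsCMField.complexConj L) 3).toAdelic (weylLongU ((IsCMField.complexConj L : L ≃ₐ[↥(maximalRealSubfield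 L)] L) : L →+* L) (rfl : (StdForm.antidiagonal 3).over L = (StdForm.antidiagonal 3).over L)) * (v : (quasiSplit (↥(maximalRealSubfield L)) L (IsCMField.complexConj L) 3).Adelic))) : ℝ) : ℂ) ^ z ∂ν) * φ₀)))))) := by rw [hRdef]
  -- the diagonal identification (Cauchy–Schwarz with EQUALITY at the spherical vector)
  have h₁ : (∫ x in {x : (AdeleRing (𝓞 L) L)ˣ | (IdeleClassGroup.ideleNorm L x : ℝ) ≤ 1} ∩ 𝓕I, ((IdeleClassGroup.ideleNorm L x : ℝ) : ℂ) ∂νI) * (((μK.real Set.univ : ℝ) : ℂ) * (φ₀ * conj φ₀)) = ((((∫ x in {x : (AdeleRing (𝓞 L) L)ˣ | (IdeleClassGroup.ideleNorm L x : ℝ) ≤ 1} ∩ 𝓕I, (IdeleClassGroup.ideleNorm L x : ℝ) ∂νI) * μK.real Set.univ * ‖φ₀‖ ^ 2) : ℝ) : ℂ) := by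
    rw [hκ, Complex.mul_conj, Complex.normSq_eq_norm_sq]; push_cast; ring
  have h₃ : (∫ x in {x : (AdeleRing (𝓞 L) L)ˣ | (IdeleClassGroup.ideleNorm L x : ℝ) ≤ 1} ∩ 𝓕I, ((IdeleClassGroup.ideleNorm L x : ℝ) : ℂ) ∂νI) * (((μK.real Set.univ : ℝ) : ℂ) * ((∫ v : ↥(adelicUnipotent (↥(maximalRealSubfield L)) L (IsCMField.complexConj L) 3), (((borelHeight ((quasiSplit (↥(maximalRealSubfield L)) L (IsCMField.complexConj L) 3).toAdelic (weylLongU ((IsCMField.complexConj L : L ≃ₐ[↥(maximalRealSubfield L)] L) : L →+* L) (rfl : (StdForm.antidiagonal 3).over L = (StdForm.antidiagonal 3).over L)) * (v : (quasiSplit (↥(maximalRealSubfield L)) L (IsCMField.complexConj L) 3).Adelic))) : ℝ) : ℂ) ^ z ∂ν) * φ₀ * conj φ₀)) = conj ((∫ x in {x : (AdeleRing (𝓞 L) L)ˣ | (IdeleClassGroup.ideleNorm L x : ℝ) ≤ 1} ∩ 𝓕I, ((IdeleClassGroup.ideleNorm L x : ℝ) : ℂ) ∂νI) * (((μK.real Set.univ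 : ℝ) : ℂ) * (φ₀ * conj ((∫ v : ↥(adelicUnipotent (↥(maximalRealSubfield L)) L (IsCMField.complexConj L) 3), (((borelHeight ((quasiSplit (↥(maximalRealSubfield L)) L (IsCMField.complexConj L) 3).toAdelic (weylLongU ((IsCMField.complexConj L : L ≃ₐ[↥(maximalRealSubfield L)] L) : L →+* L) (rfl : (StdForm.antidiagonal 3).over L = (StdForm.antidiagonal 3).over L)) * (v : (quasiSplit (↥(maximalRealSubfield L)) L (IsCMField.complexConj L) 3).Adelic))) : ℝ) : ℂ) ^ z ∂ν) * φ₀)))) := by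
    rw [hκ]; simp only [map_mul, Complex.conj_ofReal, Complex.conj_conj]; ring
  have h₄ : (∫ x in {x : (AdeleRing (𝓞 L) L)ˣ | (IdeleClassGroup.ideleNorm L x : ℝ) ≤ 1} ∩ 𝓕I, ((IdeleClassGroup.ideleNorm L x : ℝ) : ℂ) ∂νI) * (((μK.real Set.univ : ℝ) : ℂ) * ((∫ v : ↥(adelicUnipotent (↥(maximalRealSubfield L)) L (IsCMField.complexConj L) 3), (((borelHeight ((quasiSplit (↥(maximalRealSubfield L)) L (IsCMField.complexConj L) 3).toAdelic (weylLongU ((IsCMField.complexConj L : L ≃ₐ[↥(maximalRealSubfield L)] L) : L →+* L) (rfl : (StdForm.antidiagonal 3).over L = (StdForm.antidiagonal 3).over L)) * (v : (quasiSplit (↥(maximalRealSubfield L)) L (IsCMField.complexConj L) 3).Adelic))) : ℝ) : ℂ) ^ z ∂ν) * φ₀ * conj ((∫ v : ↥(adelicUnipotent (↥(maximalRealSubfield L)) L (IsCMField.complexConj L) 3), (((borelHeight ((quasiSplit (↥(maximalRealSubfield L)) L (IsCMField.complexConj L) 3).toAdelic (weylLongU ((IsCMField.complexConj L : L ≃ₐ[↥(maximalRealSubfield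 L)] L) : L →+* L) (rfl : (StdForm.antidiagonal 3).over L = (StdForm.antidiagonal 3).over L)) * (v : (quasiSplit (↥(maximalRealSubfield L)) L (IsCMField.complexConj L) 3).Adelic))) : ℝ) : ℂ) ^ z ∂ν) * φ₀))) = ((((∫ x in {x : (AdeleRing (𝓞 L) L)ˣ | (IdeleClassGroup.ideleNorm L x : ℝ) ≤ 1} ∩ 𝓕I, (IdeleClassGroup.ideleNorm L x : ℝ) ∂νI) * μK.real Set.univ * ‖(∫ v : ↥(adelicUnipotent (↥(maximalRealSubfield L)) L (IsCMField.complexConj L) 3), (((borelHeight ((quasiSplit (↥(maximalRealSubfield L)) L (IsCMField.complexConj L) 3).toAdelic (weylLongU ((IsCMField.complexConj L : L ≃ₐ[↥(maximalRealSubfield L)] L) : L →+* L) (rfl : (StdForm.antidiagonal 3).over L = (StdForm.antidiagonal 3).over L)) * (v : (quasiSplit (↥(maximalRealSubfield L)) L (IsCMField.complexConj L) 3).Adelic))) : ℝ) : ℂ) ^ z ∂ν)‖ ^ 2 * ‖φ₀‖ ^ 2) : ℝ) : ℂ) := by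
    rw [hκ, Complex.mul_conj, Complex.normSq_eq_norm_sq, norm_mul]; push_cast; ring
  have hW : ‖(∫ x in {x : (AdeleRing (𝓞 L) L)ˣ | (IdeleClassGroup.ideleNorm L x : ℝ) ≤ 1} ∩ 𝓕I, ((IdeleClassGroup.ideleNorm L x : ℝ) : ℂ) ∂νI) * (((μK.real Set.univ : ℝ) : ℂ) * (φ₀ * conj ((∫ v : ↥(adelicUnipotent (↥(maximalRealSubfield L)) L (IsCMField.complexConj L) 3), (((borelHeight ((quasiSplit (↥(maximalRealSubfield L)) L (IsCMField.complexConj L) 3).toAdelic (weylLongU ((IsCMField.complexConj L : L ≃ₐ[↥(maximalRealSubfield L)] L) : L →+* L) (rfl : (StdForm.antidiagonal 3).over L = (StdForm.antidiagonal 3).over L)) * (v : (quasiSplit (↥(maximalRealSubfield L)) L (IsCMField.complexConj L) 3).Adelic))) : ℝ) : ℂ) ^ z ∂ν) * φ₀)))‖ ^ 2 ≤ ((∫ x in {x : (AdeleRing (𝓞 L) L)ˣ | (IdeleClassGroup.ideleNorm L x : ℝ) ≤ 1} ∩ 𝓕I, (IdeleClassGroup.ideleNorm L x : ℝ) ∂νI)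 * μK.real Set.univ * ‖φ₀‖ ^ 2) * ((∫ x in {x : (AdeleRing (𝓞 L) L)ˣ | (IdeleClassGroup.ideleNorm L x : ℝ) ≤ 1} ∩ 𝓕I, (IdeleClassGroup.ideleNorm L x : ℝ) ∂νI) * μK.real Set.univ * ‖(∫ v : ↥(adelicUnipotent (↥(maximalRealSubfield L)) L (IsCMField.complexConj L) 3), (((borelHeight ((quasiSplit (↥(maximalRealSubfield L)) L (IsCMField.complexConj L) 3).toAdelic (weylLongU ((IsCMField.complexConj L : L ≃ₐ[↥(maximalRealSubfield L)] L) : L →+* L) (rfl : (StdForm.antidiagonal 3).over L = (StdForm.antidiagonal 3).over L)) * (v : (quasiSplit (↥(maximalRealSubfield L)) L (IsCMField.complexConj L) 3).Adelic))) : ℝ) : ℂ) ^ z ∂ν)‖ ^ 2 * ‖φ₀‖ ^ 2) := by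
    rw [hκ]
    simp only [norm_mul, Complex.norm_real, Complex.norm_conj, Real.norm_of_nonneg hκr.le, Real.norm_of_nonneg hm.le]
    exact le_of_eq (by ring)
  have ha : 0 < ((∫ x in {x : (AdeleRing (𝓞 L) L)ˣ | (IdeleClassGroup.ideleNorm L x : ℝ) ≤ 1} ∩ 𝓕I, (IdeleClassGroup.ideleNorm L x : ℝ) ∂νI) * μK.real Set.univ * ‖φ₀‖ ^ 2) := mul_pos (mul_pos hκr hm) (pow_pos hφ₀' 2)
  have hb : 0 ≤ ((∫ x in {x : (AdeleRing (𝓞 L) L)ˣ | (IdeleClassGroup.ideleNorm L x : ℝ) ≤ 1} ∩ 𝓕I, (IdeleClassGroup.ideleNorm L x : ℝ) ∂νI) * μK.real Set.univ * ‖(∫ v : ↥(adelicUnipotent (↥(maximalRealSubfield L)) L (IsCMField.complexConj L) 3), (((borelHeight ((quasiSplit (↥(maximalRealSubfield L)) L (IsCMField.complexConj L) 3).toAdelic (weylLongU ((IsCMField.complexConj L : L ≃ₐ[↥(maximalRealSubfield L)] L) : L →+* L) (rfl : (StdForm.antidiagonal 3).over L = (StdForm.antidiagonal 3).over L)) * (v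 : (quasiSplit (↥(maximalRealSubfield L)) L (IsCMField.complexConj L) 3).Adelic))) : ℝ) : ℂ) ^ z ∂ν)‖ ^ 2 * ‖φ₀‖ ^ 2) := by positivity
  exact poleControl_diag_flatSectionU_cm_three L ν h𝓕N (by rw [h𝓕1]; exact ENNReal.one_ne_top) hT hz hy continuous_const (M := ‖φ₀‖) (fun _ => le_rfl) (fun _ _ _ => rfl) μ hV hdecU hR hrel
    hcμ hK ha hb h₁ h₃ h₄ hW hRz

end Summit.HodgeConjecture.HodgeConjecture.Cruxes.H413.K2E1MaassSelbergPoleControlSphericalCMThree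

end
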